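import Mathlib.Analysis.Distribution.SchwartzSpace.Fourier
import Mathlib.Analysis.Distribution.Support
import Mathlib.Analysis.InnerProductSpace.PiL2
import Mathlib.MeasureTheory.Integral.Bochner.Basic
import Literature.Analysis.UnboundedOperators.SymmetricPMap
import Literature.Analysis.UnboundedOperators.SpectralGap
import Literature.Analysis.UnboundedOperators.StrongContRepresentation
import Literature.Analysis.UnboundedOperators.UnitaryRep
import HarnessLib

-- provenance: harness21/H21/H21/Prelude/UnbddOp/FourierSpectrum.lean @ 399d27b (interim HEAD d8f2665); M5 mechanical rewrite
/-!
# The Fourier spectrum of a unitary representation of a translation group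
(trunk G07 UnbddOp, item C5 `FourierSpectrum`)

Let `P` be a finite-dimensional real inner product space (space-time translations / momenta) and
`U : P → 𝒰(H)` a strongly continuous unitary representation of the translation group on a
complex Hilbert space `H`. By the SNAG theorem `U(a) = ∫ e^{i⟪p,a⟫} dE(p)` for a projection-valued
measure `E` on `P`, and the *spectral condition* of axiomatic QFT (Streater–Wightman §3.1) is a
statement about the support of `E`. We state it **without SNAG**, in the language of tempered
distributions: every matrix coefficient `a ↦ ⟪φ, U(a) ψ⟫` is a bounded continuous function, hence
a tempered distribution, and its distributional Fourier transform is the (complex) measure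
`⟪φ, E(·) ψ⟫` up to the normalisation of the Fourier kernel. `HasFourierSpectrumIn U S` says that
all these Fourier transforms vanish off `S`, using Mathlib's `Distribution.IsVanishingOn`;
`fourierSpectrum U` is the closed union of their `Distribution.dsupport`s.

## Dictionary (physical momentum units)

Mathlib's Fourier transform on `𝓢(P, ℂ)` has kernel `e^{-2πi⟪a,ξ⟫}`:
`(𝓕 g)(a) = ∫ g(ξ) e^{-2πi⟪a,ξ⟫} dξ`, so `∫ (𝓕 g)(a) e^{i⟪p,a⟫} da = g (p / 2π)` (Fourier
inversion). Hence for `U(a) = ∫ e^{i⟪p,a⟫} dE(p)`,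
`U.fourierMatrixCoeff φ ψ g = ∫ (𝓕 g)(a) ⟪φ, U(a) ψ⟫ da = ∫ g (p / 2π) d⟪φ, E(p) ψ⟫`,
a measure supported on `(2π)⁻¹ • supp E`. The predicate `HasFourierSpectrumIn U S` therefore pulls
back along `ξ ↦ 2π ξ`, so that for closed `S` one has `supp E ⊆ S ↔ U.HasFourierSpectrumIn S` with
`S` in **physical units** (`S = Ici 0` for positive energy, `{0} ∪ Ici Δ` for a mass gap `Δ`).

*Minkowski vs Euclidean pairing.* With the Euclidean inner product of `P = ℝ × ℝ^d` the
representation `U(a⁰, a⃗) = e^{i(H a⁰ - P⃗ · a⃗)}` of physics has Fourier spectrum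
`{(p⁰, -p⃗) | (p⁰, p⃗) ∈ supp E_{(H, P⃗)}}`; the closed forward light cone `{p⁰ ≥ ‖p⃗‖}` is
invariant under `p⃗ ↦ -p⃗`, so the Wightman layer (G13) may pass it verbatim.

Sources: R. F. Streater, A. S. Wightman, *PCT, Spin and Statistics, and All That* (1964), §3.1
(spectral condition); M. Reed, B. Simon, *Methods of Modern Mathematical Physics I* (1980),
§VIII.3–4 (functional calculus, Stone's theorem) and *II* (1975), §IX.1, §IX.8 (Fourier transform
of tempered distributions, SNAG); L. Hörmander, *The Analysis of Linear Partial Differential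
Operators I* (1983), §2.2 (support of a distribution), §7.1.

## Mathlib

Mathlib (pinned) has the Schwartz space `𝓢(P, ℂ)` with its Fourier transform `𝓕`
(`SchwartzMap.fourierTransformCLM`, notation via `FourierTransform`), `Distribution.IsVanishingOn`,
`Distribution.dsupport` (`Analysis/Distribution/Support.lean`, abstract over `FunLike`),
`tsupport`, the Bochner integral, `ContinuousMonoidHom` (`→ₜ*`) and `Multiplicative`. It has no
unitary representations, no SNAG theorem and no notion of (Arveson/Fourier) spectrum of a
representation; everything below is a thin layer over these anchors and items C1–C4.

## Design choices

* `fourierMatrixCoeff` is a bare function `𝓢(P, ℂ) → ℂ` (not packaged as a tempered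
  distribution): `Distribution.IsVanishingOn`/`dsupport` only need a function out of a `FunLike`
  type, and linearity/continuity are recorded as lemmas.
* Note the ascription `(𝓕 g : 𝓢(P, ℂ)) a`, needed for the coercion to a function to fire.
* The one-parameter bridges take `U : UnitaryRep (Multiplicative ℝ) H` with `P := ℝ` (its own
  one-dimensional inner product space); this is definitionally `OneParameterUnitaryGroup H`.
* `directionHom` lives directly in `namespace Literature` (like `toRealMulHom` of C3).
-/

noncomputable section

open MeasureTheory Filter Topology ComplexConjugate
open scoped InnerProductSpace FourierTransform SchwartzMap

namespace Literature.Analysis.UnboundedOperators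

variable {P : Type*} [NormedAddCommGroup P]
variable {H : Type*} [NormedAddCommGroup H] [InnerProductSpace ℂ H] [CompleteSpace H]

namespace UnitaryRep

/-! ### Matrix coefficients -/

/-- The *matrix coefficient* `a ↦ ⟪φ, U(a) ψ⟫` of a unitary representation of the translation
group `P` (Folland (1995), §3.1; Streater–Wightman (1964), §3.1). [cite: Folland1995] -/
def matrixCoeff (U : UnitaryRep (Multiplicative P) H) (φ ψ : H) : P → ℂ :=
  fun a => ⟪φ, U (Multiplicative.ofAdd a) ψ⟫_ℂ

/-- Unfolding lemma for `matrixCoeff` (Folland (1995), §3.1). [cite: Folland1995] -/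
@[simp]
theorem matrixCoeff_apply (U : UnitaryRep (Multiplicative P) H) (φ ψ : H) (a : P) :
    U.matrixCoeff φ ψ a = ⟪φ, U (Multiplicative.ofAdd a) ψ⟫_ℂ := rfl

/-- Matrix coefficients of a strongly continuous representation are continuous
(Folland (1995), §3.1). [cite: Folland1995] -/
@[continuity, fun_prop]
theorem continuous_matrixCoeff (U : UnitaryRep (Multiplicative P) H) (φ ψ : H) :
    Continuous (U.matrixCoeff φ ψ) :=
  continuous_const.inner ((U.continuous_apply_apply ψ).comp continuous_ofAdd)

/-- Matrix coefficients of a unitary representation are bounded: `‖⟪φ, U(a) ψ⟫‖ ≤ ‖φ‖ ‖ψ‖`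
(Cauchy–Schwarz and `‖U(a) ψ‖ = ‖ψ‖`; Folland (1995), §3.1). [cite: Folland1995] -/
theorem norm_matrixCoeff_le (U : UnitaryRep (Multiplicative P) H) (φ ψ : H) (a : P) :
    ‖U.matrixCoeff φ ψ a‖ ≤ ‖φ‖ * ‖ψ‖ := by
  simpa [matrixCoeff] using norm_inner_le_norm φ (U (Multiplicative.ofAdd a) ψ)

/-! ### Distributional Fourier transforms of matrix coefficients -/

section Fourier

variable [InnerProductSpace ℝ P] [FiniteDimensional ℝ P] [MeasurableSpace P] [BorelSpace P]

/-- The *distributional Fourier transform of the matrix coefficient* `a ↦ ⟪φ, U(a) ψ⟫`, as a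
functional on Schwartz test functions: `g ↦ ∫ (𝓕 g)(a) ⟪φ, U(a) ψ⟫ da`. With Mathlib's kernel
`e^{-2πi⟪a,ξ⟫}` and `U(a) = ∫ e^{i⟪p,a⟫} dE(p)` this equals `∫ g (p / 2π) d⟪φ, E(p) ψ⟫`
(Reed–Simon II, §IX.1, Fourier transform of a tempered distribution `T̂(g) = T(ĝ)`;
Streater–Wightman (1964), §3.1). [cite: StreaterWightman1964] -/
def fourierMatrixCoeff (U : UnitaryRep (Multiplicative P) H) (φ ψ : H) : 𝓢(P, ℂ) → ℂ :=
  fun g => ∫ a, (𝓕 g : 𝓢(P, ℂ)) a * U.matrixCoeff φ ψ a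

/-- Unfolding lemma for `fourierMatrixCoeff` (Reed–Simon II, §IX.1). [folklore] -/
theorem fourierMatrixCoeff_apply (U : UnitaryRep (Multiplicative P) H) (φ ψ : H) (g : 𝓢(P, ℂ)) :
    U.fourierMatrixCoeff φ ψ g = ∫ a, (𝓕 g : 𝓢(P, ℂ)) a * U.matrixCoeff φ ψ a := rfl

/-- The Fourier-transformed matrix coefficient is additive in the test function (linearity of
`𝓕` and of the integral against a bounded continuous function; Reed–Simon II, §IX.1); proved below,
`fourierMatrixCoeff_add_holds`. [cite: ReedSimonII1975, §IX.1] -/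
def fourierMatrixCoeff_add : Prop :=
  ∀ (U : UnitaryRep (Multiplicative P) H) (φ ψ : H) (g₁ g₂ : 𝓢(P, ℂ)),
    U.fourierMatrixCoeff φ ψ (g₁ + g₂) = U.fourierMatrixCoeff φ ψ g₁ + U.fourierMatrixCoeff φ ψ g₂

/-- The Fourier-transformed matrix coefficient is homogeneous in the test function
(Reed–Simon II, §IX.1); proved below, `fourierMatrixCoeff_smul_holds`. [cite: ReedSimonII1975, §IX.1] -/
def fourierMatrixCoeff_smul : Prop :=
  ∀ (U : UnitaryRep (Multiplicative P) H) (φ ψ : H) (c : ℂ) (g : 𝓢(P, ℂ)),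
    U.fourierMatrixCoeff φ ψ (c • g) = c * U.fourierMatrixCoeff φ ψ g

/-- The Fourier-transformed matrix coefficient is continuous on the Schwartz space, i.e. it is a
tempered distribution (a bounded continuous function is a tempered distribution and `𝓕` is
continuous on `𝓢`; Reed–Simon II, §IX.1, Thm. IX.1); proved below,
`continuous_fourierMatrixCoeff_holds`. [cite: ReedSimonII1975, §IX.1 Thm IX.1] -/
def continuous_fourierMatrixCoeff : Prop :=
  ∀ (U : UnitaryRep (Multiplicative P) H) (φ ψ : H),
    Continuous (U.fourierMatrixCoeff φ ψ)

/-! ### The spectral condition -/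

/-- **Spectral condition** `HasFourierSpectrumIn U S`: the distributional Fourier transform of
every matrix coefficient of `U` vanishes off `(ξ ↦ 2π ξ) ⁻¹' S`, i.e. (dictionary in the module
docstring) the spectral measure `E` of `U(a) = ∫ e^{i⟪p,a⟫} dE(p)` is supported in `S`, with `S`
in physical momentum units (Streater–Wightman (1964), §3.1, spectral condition; Reed–Simon II,
§IX.8; Mathlib: `Distribution.IsVanishingOn`). Intended for closed `S`. [cite: StreaterWightman1964] -/
def HasFourierSpectrumIn (U : UnitaryRep (Multiplicative P) H) (S : Set P) : Prop :=
  ∀ φ ψ, Distribution.IsVanishingOn (U.fourierMatrixCoeff φ ψ)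
    ((fun ξ : P => (2 * Real.pi) • ξ) ⁻¹' S)ᶜ

/-- Every representation has Fourier spectrum in the whole momentum space (only the zero test
function has support in `∅`); proved below, `hasFourierSpectrumIn_univ_holds`. [folklore] -/
def hasFourierSpectrumIn_univ : Prop :=
  ∀ (U : UnitaryRep (Multiplicative P) H),
    U.HasFourierSpectrumIn Set.univ

/-- The spectral condition is monotone in the set (Mathlib: `Distribution.IsVanishingOn.mono`). [folklore] -/
theorem HasFourierSpectrumIn.mono {U : UnitaryRep (Multiplicative P) H} {S T : Set P}
    (h : U.HasFourierSpectrumIn S) (hST : S ⊆ T) : U.HasFourierSpectrumIn T :=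
  fun φ ψ => (h φ ψ).mono (Set.compl_subset_compl.mpr (Set.preimage_mono hST))

/-- The *Fourier spectrum* of `U`: the closure of the union over `φ ψ` of the distributional
supports of the Fourier-transformed matrix coefficients, rescaled to physical momentum units
(`ξ ↦ 2π ξ`). Under SNAG this is the support of the projection-valued measure `E`, i.e. the joint
spectrum of the energy–momentum operators (Streater–Wightman (1964), §3.1; Reed–Simon II, §IX.8;
Mathlib: `Distribution.dsupport`). [cite: StreaterWightman1964] -/
def fourierSpectrum (U : UnitaryRep (Multiplicative P) H) : Set P :=
  closure ((fun ξ : P => (2 * Real.pi) • ξ) ''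
    ⋃ (φ : H) (ψ : H), Distribution.dsupport (U.fourierMatrixCoeff φ ψ))

/-- The Fourier spectrum is closed (by definition, as a closure). [folklore] -/
theorem isClosed_fourierSpectrum (U : UnitaryRep (Multiplicative P) H) :
    IsClosed U.fourierSpectrum :=
  isClosed_closure

/-- `U` has Fourier spectrum in its Fourier spectrum: each Fourier-transformed matrix coefficient
vanishes off its own distributional support (Hörmander I, Thm. 2.2.1; Mathlib:
`Distribution.dsupport`). [cite: HormanderALPDO1, Thm 2.2.1] -/
def hasFourierSpectrumIn_fourierSpectrum : Prop :=
  ∀ (U : UnitaryRep (Multiplicative P) H),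
    U.HasFourierSpectrumIn U.fourierSpectrum

/-- For closed `S`, the spectral condition `HasFourierSpectrumIn U S` holds iff the Fourier
spectrum is contained in `S` (the support is the smallest closed set off which a distribution
vanishes; Hörmander I, §2.2; Streater–Wightman (1964), §3.1). [cite: StreaterWightman1964] -/
def hasFourierSpectrumIn_iff_fourierSpectrum_subset : Prop :=
  ∀ (U : UnitaryRep (Multiplicative P) H) {S : Set P} (hS : IsClosed S),
    U.HasFourierSpectrumIn S ↔ U.fourierSpectrum ⊆ S

/-- Test-function form of the spectral condition: `U` has Fourier spectrum in `S` iff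
`∫ f(a) ⟪φ, U(a) ψ⟫ da = 0` for every Schwartz `f` whose Fourier transform `𝓕 f` is supported
away from `-(2π)⁻¹ • S` (substitute `g = 𝓕 f`, so `𝓕 g = f(-·)`; Streater–Wightman (1964), §3.1,
eq. (3-4); Reed–Simon II, §IX.1). [cite: StreaterWightman1964] -/
def hasFourierSpectrumIn_iff_integral_eq_zero : Prop :=
  ∀ (U : UnitaryRep (Multiplicative P) H) (S : Set P),
    U.HasFourierSpectrumIn S ↔ ∀ (φ ψ : H) (f : 𝓢(P, ℂ)),
      Disjoint (tsupport ⇑(𝓕 f : 𝓢(P, ℂ))) ((fun ξ : P => (-(2 * Real.pi)) • ξ) ⁻¹' S) →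
        ∫ a, f a * U.matrixCoeff φ ψ a = 0

end Fourier

end UnitaryRep

/-! ### Translations along a direction and momentum operators -/

section Direction

variable [NormedSpace ℝ P]

/-- The one-parameter subgroup `t ↦ t • e` of the translation group in the direction `e : P`, as
a continuous monoid homomorphism `Multiplicative ℝ →ₜ* Multiplicative P`
(Reed–Simon I, §VIII.4, one-parameter subgroups). [folklore] -/
def directionHom (e : P) : Multiplicative ℝ →ₜ* Multiplicative P where
  toFun t := Multiplicative.ofAdd (Multiplicative.toAdd t • e)
  map_one' := by simp
  map_mul' s t := by simp [← ofAdd_add, add_smul]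
  continuous_toFun := continuous_ofAdd.comp (continuous_toAdd.smul continuous_const)

/-- `directionHom e (ofAdd t) = ofAdd (t • e)` (Reed–Simon I, §VIII.4). [folklore] -/
@[simp]
theorem directionHom_apply (e : P) (t : ℝ) :
    directionHom e (Multiplicative.ofAdd t) = Multiplicative.ofAdd (t • e) := rfl

namespace UnitaryRep

/-- The one-parameter unitary group `t ↦ U(t • e)` of translations along `e : P`
(Reed–Simon I, §VIII.4; Streater–Wightman (1964), §3.1). [cite: StreaterWightman1964] -/
def alongDirection (U : UnitaryRep (Multiplicative P) H) (e : P) : OneParameterUnitaryGroup H :=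
  U.restrict (directionHom e)

/-- `U.alongDirection e (ofAdd t) = U (ofAdd (t • e))` (Reed–Simon I, §VIII.4). [folklore] -/
@[simp]
theorem alongDirection_apply (U : UnitaryRep (Multiplicative P) H) (e : P) (t : ℝ) :
    U.alongDirection e (Multiplicative.ofAdd t) = U (Multiplicative.ofAdd (t • e)) := rfl

/-- The *momentum operator* in the direction `e`: the Hamiltonian (Stone generator, physics sign
`U(t • e) = exp (i t P_e)`, item C4) of the one-parameter group of translations along `e`
(Stone (1932); Reed–Simon I, Thm. VIII.8; Streater–Wightman (1964), §3.1, energy–momentum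
operators). [cite: Stone1932] -/
def momentum (U : UnitaryRep (Multiplicative P) H) (e : P) : H →ₗ.[ℂ] H :=
  (U.alongDirection e).hamiltonian

end UnitaryRep

end Direction

namespace UnitaryRep

/-! ### One-parameter bridges (`P = ℝ`) -/

/-- For a one-parameter unitary group `U(t) = e^{itH}`, positivity of the Hamiltonian is
equivalent to the spectral condition with `S = [0, ∞)` (Stone's theorem and the spectral theorem:
`⟪φ, U(t) ψ⟫ = ∫ e^{itλ} d⟪φ, E_H(λ) ψ⟫` and `H ≥ 0 ↔ supp E_H ⊆ [0, ∞)`;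
Reed–Simon I, §VIII.3–4; Streater–Wightman (1964), §3.1). [cite: StreaterWightman1964] -/
def hasPositiveEnergy_iff_hasFourierSpectrumIn_Ici : Prop :=
  ∀ (U : UnitaryRep (Multiplicative ℝ) H),
    U.HasPositiveEnergy ↔ U.HasFourierSpectrumIn (Set.Ici 0)

/-- For a one-parameter unitary group `U(t) = e^{itH}`, the Hamiltonian has a unique ground state
`Ω` at energy `0` with gap `Δ` iff `Ω` is the unique vacuum of `U`, `0 < Δ`, and the Fourier
spectrum of `U` lies in `{0} ∪ [Δ, ∞)` (Stone's theorem, the spectral theorem and min–max;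
Reed–Simon I, §VIII.3–4, Reed–Simon IV, Thm. XIII.1; Streater–Wightman (1964), §3.1;
Glimm–Jaffe, *Quantum Physics*, §6.1, mass gap). [cite: StreaterWightman1964] -/
def hasGroundStateGap_hamiltonian_iff : Prop :=
  ∀ (U : UnitaryRep (Multiplicative ℝ) H) (Ω : H) (Δ : ℝ),
    U.hamiltonian.HasGroundStateGap Ω Δ ↔
      U.HasUniqueVacuum Ω ∧ 0 < Δ ∧ U.HasFourierSpectrumIn ({0} ∪ Set.Ici Δ)

end UnitaryRep

/-! ### Discharge of the linearity, continuity and trivial-spectrum facts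

Appended (literature-prover, 2026-08-15): the Fourier-transformed matrix coefficient
`g ↦ ∫ 𝓕g(a) ⟪φ, U(a)ψ⟫ da` is additive, homogeneous and continuous on `𝓢(P, ℂ)` — a bounded
continuous function is a tempered distribution and `𝓕` is continuous on `𝓢` (Reed–Simon II, §IX.1,
Thm IX.1) — and every representation has Fourier spectrum in the whole momentum space. -/

namespace UnitaryRep

section FourierProofs

variable [InnerProductSpace ℝ P] [FiniteDimensional ℝ P] [MeasurableSpace P] [BorelSpace P]

/-- `G · ⟪φ, U(·)ψ⟫` is integrable for `G` Schwartz (Schwartz times bounded continuous).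
[folklore] -/
theorem integrable_mul_matrixCoeff (U : UnitaryRep (Multiplicative P) H) (φ ψ : H)
    (G : 𝓢(P, ℂ)) : Integrable fun a => G a * U.matrixCoeff φ ψ a := by
  refine ((G.integrable.norm.mul_const (‖φ‖ * ‖ψ‖)).mono'
    ((G.continuous.mul (U.continuous_matrixCoeff φ ψ)).aestronglyMeasurable)
    (Eventually.of_forall fun a => ?_))
  rw [norm_mul]
  exact mul_le_mul_of_nonneg_left (U.norm_matrixCoeff_le φ ψ a) (norm_nonneg _)

/-- `𝓕g · ⟪φ, U(·)ψ⟫` is integrable. [folklore] -/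
theorem integrable_fourier_mul_matrixCoeff (U : UnitaryRep (Multiplicative P) H) (φ ψ : H)
    (g : 𝓢(P, ℂ)) : Integrable fun a => (𝓕 g : 𝓢(P, ℂ)) a * U.matrixCoeff φ ψ a :=
  U.integrable_mul_matrixCoeff φ ψ (𝓕 g)

/-- **`fourierMatrixCoeff_add` holds**: additivity in the test function (linearity of `𝓕` and of
the integral against the bounded continuous coefficient). [folklore] -/
theorem fourierMatrixCoeff_add_holds : fourierMatrixCoeff_add (P := P) (H := H) := by
  intro U φ ψ g₁ g₂
  simp only [fourierMatrixCoeff_apply]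
  rw [← integral_add (U.integrable_fourier_mul_matrixCoeff φ ψ g₁)
    (U.integrable_fourier_mul_matrixCoeff φ ψ g₂)]
  refine integral_congr_ae (Eventually.of_forall fun a => ?_)
  rw [FourierTransform.fourier_add]
  simp [add_mul]

/-- **`fourierMatrixCoeff_smul` holds**: homogeneity in the test function. [folklore] -/
theorem fourierMatrixCoeff_smul_holds : fourierMatrixCoeff_smul (P := P) (H := H) := by
  intro U φ ψ c g
  simp only [fourierMatrixCoeff_apply]
  rw [FourierTransform.fourier_smul, ← integral_const_mul]
  refine integral_congr_ae (Eventually.of_forall fun a => ?_)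
  simp [mul_assoc]

/-- **`continuous_fourierMatrixCoeff` holds**: the Fourier-transformed matrix coefficient is a
tempered distribution. The pairing `G ↦ ∫ G(a) ⟪φ, U(a)ψ⟫ da` is bounded by
`‖φ‖ ‖ψ‖ ‖G‖_{L¹}`, which is controlled by finitely many Schwartz seminorms
(`SchwartzMap.norm_toLp_le_seminorm`), so it is a continuous linear functional on `𝓢`
(`SchwartzMap.mkCLMtoNormedSpace`); and `𝓕` is continuous on `𝓢` (Reed–Simon II, Thm IX.1).
[cite: ReedSimonII1975, §IX.1 Thm IX.1] -/
theorem continuous_fourierMatrixCoeff_holds : continuous_fourierMatrixCoeff (P := P) (H := H) := by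
  intro U φ ψ
  obtain ⟨k, C, hC0, hCb⟩ :=
    SchwartzMap.norm_toLp_le_seminorm ℂ ℂ (1 : ENNReal) (MeasureTheory.volume : Measure P)
  have hbound : ∀ G : 𝓢(P, ℂ), ‖∫ a, G a * U.matrixCoeff φ ψ a‖ ≤
      ‖φ‖ * ‖ψ‖ * C * (Finset.Iic (k, 0)).sup (schwartzSeminormFamily ℂ P ℂ) G := by
    intro G
    calc ‖∫ a, G a * U.matrixCoeff φ ψ a‖ ≤ ∫ a, ‖G a * U.matrixCoeff φ ψ a‖ :=
          norm_integral_le_integral_norm _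
      _ ≤ ∫ a, ‖G a‖ * (‖φ‖ * ‖ψ‖) := by
          refine integral_mono_of_nonneg (Eventually.of_forall fun a => norm_nonneg _)
            (G.integrable.norm.mul_const _) (Eventually.of_forall fun a => ?_)
          dsimp only
          rw [norm_mul]
          exact mul_le_mul_of_nonneg_left (U.norm_matrixCoeff_le φ ψ a) (norm_nonneg _)
      _ = ‖φ‖ * ‖ψ‖ * ‖G.toLp 1 (MeasureTheory.volume : Measure P)‖ := by
          rw [integral_mul_const, SchwartzMap.norm_toLp_one, mul_comm]
      _ ≤ ‖φ‖ * ‖ψ‖ * (C * (Finset.Iic (k, 0)).sup (schwartzSeminormFamily ℂ P ℂ) G) := by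
          gcongr
          exact hCb G
      _ = ‖φ‖ * ‖ψ‖ * C * (Finset.Iic (k, 0)).sup (schwartzSeminormFamily ℂ P ℂ) G := by ring
  let A : 𝓢(P, ℂ) →L[ℂ] ℂ := SchwartzMap.mkCLMtoNormedSpace
    (fun G : 𝓢(P, ℂ) => ∫ a, G a * U.matrixCoeff φ ψ a)
    (fun G G' => by
      change ∫ a, (G + G') a * U.matrixCoeff φ ψ a =
        (∫ a, G a * U.matrixCoeff φ ψ a) + ∫ a, G' a * U.matrixCoeff φ ψ a
      rw [← integral_add (U.integrable_mul_matrixCoeff φ ψ G)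
        (U.integrable_mul_matrixCoeff φ ψ G')]
      refine integral_congr_ae (Eventually.of_forall fun a => ?_)
      simp [add_mul])
    (fun c G => by
      change ∫ a, (c • G) a * U.matrixCoeff φ ψ a = c • ∫ a, G a * U.matrixCoeff φ ψ a
      rw [smul_eq_mul, ← integral_const_mul]
      refine integral_congr_ae (Eventually.of_forall fun a => ?_)
      simp [mul_assoc])
    ⟨Finset.Iic (k, 0), ‖φ‖ * ‖ψ‖ * C, by positivity, hbound⟩
  have hA : U.fourierMatrixCoeff φ ψ = fun g => A (𝓕 g) := rfl
  rw [hA]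
  exact A.continuous.comp (FourierTransform.fourierCLM ℂ (𝓢(P, ℂ))).continuous

/-- **`hasFourierSpectrumIn_univ` holds**: only the zero test function is supported in `∅`.
[folklore] -/
theorem hasFourierSpectrumIn_univ_holds : hasFourierSpectrumIn_univ (P := P) (H := H) := by
  intro U φ ψ u hu
  simp only [Set.preimage_univ, Set.compl_univ, Set.subset_empty_iff] at hu
  have hu0 : u = 0 := SchwartzMap.ext fun x =>
    image_eq_zero_of_notMem_tsupport (by rw [hu]; exact Set.notMem_empty x)
  rw [hu0, fourierMatrixCoeff_apply, FourierTransform.fourier_zero]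
  simp

end FourierProofs

end UnitaryRep

end Literature.Analysis.UnboundedOperators
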